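import Mathlib
import Summits.Ventures.PercRepro2.SwOutAll
import Summits.Ventures.PercRepro2.SwOutMixedPiecesThm

/-!
# The m-piece big-block lemma, block-lowerness form (blind cell PercRepro2, night-4 g20,
2026-08-27; proofs/NIGHT4-G20.md §3)

`mixedPieces_card_le'`: lowerness is only needed BETWEEN NON-LEAKING POINTS (what a geometric
chain supplies — the moves between class points), exactly as `BigBlock.mixedCore_card_le'` for one
piece: apply `mixedPieces_card_le` to the down-closure of the non-leaking part of `Q`, which is a
lower set with `G5` (the two points of a `G5` instance are non-leaking: a T-slab and a B-slab
point) whose non-leaking part is that of `Q`.  Then the EDGE-SET FORM `card_le_of_mixedPieces_edges`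
(the twin of `BigBlock.card_le_of_mixedCore_edges`): the interface a geometric chain for a mixed
base with several pieces plugs into — a realisation `r` of the non-leaking points, a monotone map
`φ` of atom sets to edge sets, block-lowerness and `G5` of the pulled-back conditioning.
-/

namespace Summit.Ventures.PercRepro2

namespace MixedPieces

open scoped Classical

variable {ι μ κ : Type*}

section BlockLower

variable (Q : Set (PtM ι μ κ))

/-- Lowerness ON THE BLOCK ONLY: `q ≤ p` with both non-leaking and `p ∈ Q` gives `q ∈ Q`. -/
def BlockLower : Prop := ∀ p q, ¬ Leak p → ¬ Leak q → q ≤ p → p ∈ Q → q ∈ Q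

/-- The down-closure of the non-leaking part of `Q`. -/
def downBlock : Set (PtM ι μ κ) := {q | ∃ p, p ∈ Q ∧ ¬ Leak p ∧ q ≤ p}

variable {Q}

/-- A lower set is block-lower. -/
lemma BlockLower.of_isLowerSet (hQ : IsLowerSet Q) : BlockLower Q :=
  fun _ _ _ _ hle hp => hQ hle hp

/-- The down-closure is a lower set. -/
lemma isLowerSet_downBlock : IsLowerSet (downBlock Q) := by
  rintro q q' hle ⟨p, hp, hL, hqp⟩
  exact ⟨p, hp, hL, le_trans hle hqp⟩

/-- On the non-leaking points, the down-closure of a block-lower `Q` is `Q`. -/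
lemma mem_downBlock_iff (hQ : BlockLower Q) {q : PtM ι μ κ} (hq : ¬ Leak q) :
    q ∈ downBlock Q ↔ q ∈ Q := by
  constructor
  · rintro ⟨p, hp, hL, hqp⟩
    exact hQ p q hL hq hqp hp
  · intro h
    exact ⟨q, h, hq, le_rfl⟩

/-- The source of a `G5` instance is a T-slab point, hence non-leaking. -/
lemma not_leak_G5_src (a : Config μ) (e : Bool) (f : Config κ) :
    ¬ Leak (((fun _ => true) : Config ι), a, false, e, f) :=
  (not_leak_iff _).2 (Or.inr (Or.inl ⟨rfl, rfl⟩))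

/-- The target of a `G5` instance is a B-slab point, hence non-leaking. -/
lemma not_leak_G5_tgt (a : Config μ) (e : Bool) (f : Config κ) :
    ¬ Leak (((fun _ => false) : Config ι), a, true, e, f) :=
  (not_leak_iff _).2 (Or.inr (Or.inr ⟨rfl, rfl⟩))

/-- `G5` passes to the down-closure. -/
lemma G5_downBlock (hQ : BlockLower Q) (hG : G5 Q) : G5 (downBlock Q) := by
  intro a e f h
  rw [mem_downBlock_iff hQ (not_leak_G5_src a e f)] at h
  rw [mem_downBlock_iff hQ (not_leak_G5_tgt a e f)]
  exact hG a e f h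

variable [Fintype ι] [DecidableEq ι] [Fintype μ] [DecidableEq μ] [Fintype κ] [DecidableEq κ]

/-- **The m-piece big-block lemma, block-lowerness form**: lowerness is only needed between
non-leaking points. -/
theorem mixedPieces_card_le' (hQ : BlockLower Q) (hG : G5 Q) {𝓔 : Set (Set (AtomM ι μ κ))}
    (h𝓔 : IsUpperSet 𝓔) :
    (Finset.univ.filter fun p : PtM ι μ κ => p ∈ Q ∧ ¬ Leak p ∧ ER p ∈ 𝓔).card ≤
      (Finset.univ.filter fun p : PtM ι μ κ => p ∈ Q ∧ ¬ Leak p ∧ EB p ∈ 𝓔).card := by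
  have key := mixedPieces_card_le (isLowerSet_downBlock (Q := Q)) (G5_downBlock hQ hG) h𝓔
  have e1 : ∀ R : PtM ι μ κ → Prop,
      (Finset.univ.filter fun p : PtM ι μ κ => p ∈ downBlock Q ∧ ¬ Leak p ∧ R p) =
        (Finset.univ.filter fun p : PtM ι μ κ => p ∈ Q ∧ ¬ Leak p ∧ R p) := by
    intro R
    apply Finset.filter_congr
    intro p _
    constructor
    · rintro ⟨h1, h2, h3⟩
      exact ⟨(mem_downBlock_iff hQ h2).1 h1, h2, h3⟩
    · rintro ⟨h1, h2, h3⟩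
      exact ⟨(mem_downBlock_iff hQ h2).2 h1, h2, h3⟩
  rw [e1 (fun p => ER p ∈ 𝓔), e1 (fun p => EB p ∈ 𝓔)] at key
  exact key

end BlockLower

section Transfer

open LocRows

variable {V : Type*} {E : Type*} [Fintype E]
variable [Fintype ι] [DecidableEq ι] [Fintype μ] [DecidableEq μ] [Fintype κ] [DecidableEq κ]

/-- **The m-piece big-block principle, edge-set form**: a block `C` of configurations that is the
injective image of the non-leaking points of the m-piece raw cube under a realisation `r`, on which
the red edge set of `h` is the image of the abstract red set `ER` under a monotone map `φ` of atom
sets to edge sets (and the blue edge set the image of `EB`), and whose conditioning pulls back to a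
block-lower set with `G5`, satisfies the rigid counting inequality on `C ∩ Qs` for every up-set
`𝓔` of edge sets — the m-piece twin of `BigBlock.card_le_of_mixedCore_edges`; a geometric chain
for a mixed base with several pieces only has to build `r` and `φ` and check these hypotheses. -/
theorem card_le_of_mixedPieces_edges {ends : E → Sym2 V} (r : PtM ι μ κ → Config E)
    (hr : ∀ p q, ¬ Leak p → ¬ Leak q → r p = r q → p = q) (C : Finset (Config E))
    (hC : ∀ ζ, ζ ∈ C ↔ ∃ p, ¬ Leak p ∧ r p = ζ) (Qs : Set (Config E))
    (hEv : ∀ p q, ¬ Leak p → ¬ Leak q → q ≤ p → r p ∈ Qs → r q ∈ Qs)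
    (hG : G5 {p | r p ∈ Qs}) (h : V)
    (φ : Set (AtomM ι μ κ) → Set E) (hφ : Monotone φ)
    (hR : ∀ p, ¬ Leak p → redEdges ends (r p) h = φ (ER p))
    (hB : ∀ p, ¬ Leak p → blueEdges ends (r p) h = φ (EB p))
    {𝓔 : Set (Set E)} (h𝓔 : IsUpperSet 𝓔) :
    (C.filter fun ζ => ζ ∈ Qs ∧ redEdges ends ζ h ∈ 𝓔).card ≤
      (C.filter fun ζ => ζ ∈ Qs ∧ blueEdges ends ζ h ∈ 𝓔).card := by
  have e1 : (C.filter fun ζ => ζ ∈ Qs ∧ redEdges ends ζ h ∈ 𝓔) =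
      (Finset.univ.filter fun p : PtM ι μ κ => r p ∈ Qs ∧ ¬ Leak p ∧ ER p ∈ φ ⁻¹' 𝓔).image r := by
    ext ζ
    simp only [Finset.mem_filter, Finset.mem_image, Finset.mem_univ, true_and, Set.mem_preimage]
    constructor
    · rintro ⟨hζ, hQ, hE⟩
      obtain ⟨p, hp, rfl⟩ := (hC ζ).1 hζ
      refine ⟨p, ⟨hQ, hp, ?_⟩, rfl⟩
      rw [← hR p hp]
      exact hE
    · rintro ⟨p, ⟨hQ, hp, hE⟩, rfl⟩
      refine ⟨(hC _).2 ⟨p, hp, rfl⟩, hQ, ?_⟩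
      rw [hR p hp]
      exact hE
  have e2 : (C.filter fun ζ => ζ ∈ Qs ∧ blueEdges ends ζ h ∈ 𝓔) =
      (Finset.univ.filter fun p : PtM ι μ κ => r p ∈ Qs ∧ ¬ Leak p ∧ EB p ∈ φ ⁻¹' 𝓔).image r := by
    ext ζ
    simp only [Finset.mem_filter, Finset.mem_image, Finset.mem_univ, true_and, Set.mem_preimage]
    constructor
    · rintro ⟨hζ, hQ, hE⟩
      obtain ⟨p, hp, rfl⟩ := (hC ζ).1 hζ
      refine ⟨p, ⟨hQ, hp, ?_⟩, rfl⟩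
      rw [← hB p hp]
      exact hE
    · rintro ⟨p, ⟨hQ, hp, hE⟩, rfl⟩
      refine ⟨(hC _).2 ⟨p, hp, rfl⟩, hQ, ?_⟩
      rw [hB p hp]
      exact hE
  have inj1 : Set.InjOn r
      ↑(Finset.univ.filter fun p : PtM ι μ κ => r p ∈ Qs ∧ ¬ Leak p ∧ ER p ∈ φ ⁻¹' 𝓔) := by
    intro p hp q hq hpq
    simp only [Finset.coe_filter, Finset.mem_univ, true_and, Set.mem_setOf_eq] at hp hq
    exact hr p q hp.2.1 hq.2.1 hpq
  have inj2 : Set.InjOn r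
      ↑(Finset.univ.filter fun p : PtM ι μ κ => r p ∈ Qs ∧ ¬ Leak p ∧ EB p ∈ φ ⁻¹' 𝓔) := by
    intro p hp q hq hpq
    simp only [Finset.coe_filter, Finset.mem_univ, true_and, Set.mem_setOf_eq] at hp hq
    exact hr p q hp.2.1 hq.2.1 hpq
  rw [e1, e2, Finset.card_image_of_injOn inj1, Finset.card_image_of_injOn inj2]
  have h𝓔' : IsUpperSet (φ ⁻¹' 𝓔) := by
    intro S S' hSS' hS
    exact h𝓔 (hφ hSS') hS
  exact mixedPieces_card_le' hEv hG h𝓔'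

end Transfer

end MixedPieces

end Summit.Ventures.PercRepro2
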